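import Summits.Ventures.PercRepro.RankLevelSetUpFiveTargets

/-! # RankLevelSetUpFiveTargetsA — THE TYPE-A TARGET OF THE COLOOP RESIDUE (P) (night-1 g41; dossier §53; on
`RankLevelSetUpFiveTargets`)

The second target shape of the charging of §53: when the marked element `b` lies ON the long line `L = cl L'` of a
bad member `W` (`E ∖ W = C ⊔ L'`, `C` the three coloops), the pairs `(Z, t)` with `Z = (W ∖ b) ∪ {ℓ, ℓ'}`,
`{ℓ, ℓ'} ⊆ L'`, `t ∈ C` are charged. **`typeA_target_valid`**: `Z` spans as soon as `{ℓ, ℓ'} ⊄ cl (W ∖ b)`;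
`E ∖ Z ⊇ (L' ∖ {ℓ, ℓ'}) ∪ C ∪ {b}` spans unconditionally (`(L' ∖ {ℓ, ℓ'}) ∪ {b}` has `≥ 3` points of the line, hence
rank `2`, hence spans the line); and every `t ∈ C` is a coloop of `N|(E ∖ Z)`, since `(E ∖ Z) ∖ t` sits inside
`cl L' ∪ (C ∖ t)` of rank `≤ 2 + 2`. Every declaration has a docstring; imports: the cell's own modules and Mathlib
only. Axioms: standard. -/

namespace PercRepro

open Set Matroid

variable {α : Type}

/-! ## The type-A target -/

/-- **THE TYPE-A TARGET IS VALID** (night-1 g41, §53): `N` of rank `5`, loopless, without a parallel triple; `W` a base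
through `b` whose complement is `C ⊔ L'` with `L'` of rank `≤ 2` and `≥ 4` elements, `b ∈ cl L'` (the marked element
is ON the line), `C ∪ L'` spanning (the complement of the base) and `C` of three elements; `ℓ ≠ ℓ'` in `L'` with
`{ℓ, ℓ'} ⊄ cl (W ∖ b)`. Then `Z := (W ∖ b) ∪ {ℓ, ℓ'}` spans, `E ∖ Z` spans, and every `t ∈ C` is a coloop of
`N|(E ∖ Z)`. -/
theorem typeA_target_valid {N : Matroid α} [N.Finite] (h5 : N.eRank = 5)
    (hnl : ∀ e ∈ N.E, N.IsNonloop e)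
    (hnt : ∀ p ∈ N.E, ∀ q ∈ N.E, ∀ r ∈ N.E, p ≠ q → p ≠ r → q ≠ r → q ∈ N.closure {p} → r ∉ N.closure {p})
    {W : Set α} (hW : N.IsBase W) {b : α} (hb : b ∈ W)
    {C L' : Set α} (hY : N.E \ W = C ∪ L') (hdj : Disjoint C L') (hL2 : N.eRk L' ≤ 2) (hL4 : 4 ≤ L'.ncard)
    (hC3 : C.ncard = 3) (hbL : b ∈ N.closure L') (hYsp : N.Spanning (C ∪ L'))
    {ℓ ℓ' : α} (hℓ : ℓ ∈ L') (hℓ' : ℓ' ∈ L') (hne : ℓ ≠ ℓ') (hZ : ¬ ({ℓ, ℓ'} ⊆ N.closure (W \ {b}))) :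
    N.Spanning ((W \ {b}) ∪ {ℓ, ℓ'}) ∧ N.Spanning (N.E \ ((W \ {b}) ∪ {ℓ, ℓ'})) ∧
      ∀ t ∈ C, ¬ N.Spanning ((N.E \ ((W \ {b}) ∪ {ℓ, ℓ'})) \ {t}) := by
  classical
  have hWE : W ⊆ N.E := hW.subset_ground
  have hCE : C ⊆ N.E := fun x hx => (hY ▸ (Set.mem_union_left L' hx) : x ∈ N.E \ W).1
  have hLE : L' ⊆ N.E := fun x hx => (hY ▸ (Set.mem_union_right C hx) : x ∈ N.E \ W).1
  have hCW : ∀ x ∈ C, x ∉ W := fun x hx => (hY ▸ (Set.mem_union_left L' hx) : x ∈ N.E \ W).2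
  have hLW : ∀ x ∈ L', x ∉ W := fun x hx => (hY ▸ (Set.mem_union_right C hx) : x ∈ N.E \ W).2
  have hℓE : ℓ ∈ N.E := hLE hℓ
  have hℓ'E : ℓ' ∈ N.E := hLE hℓ'
  have hℓW : ℓ ∉ W := hLW ℓ hℓ
  have hℓ'W : ℓ' ∉ W := hLW ℓ' hℓ'
  have hbℓ : b ≠ ℓ := fun h => hℓW (h ▸ hb)
  have hbℓ' : b ≠ ℓ' := fun h => hℓ'W (h ▸ hb)
  set Z := (W \ {b}) ∪ {ℓ, ℓ'} with hZdef
  have hZE : Z ⊆ N.E := by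
    intro x hx
    rcases hx with hx | hx
    · exact hWE hx.1
    · rcases hx with rfl | rfl
      · exact hℓE
      · exact hℓ'E
  -- (1) `Z` spans
  have hZsp : N.Spanning Z := by
    obtain ⟨x, hxℓ, hx⟩ := Set.not_subset.mp hZ
    have hxE : x ∈ N.E := by
      rcases hxℓ with rfl | rfl
      · exact hℓE
      · exact hℓ'E
    have hxW : x ∉ W := by
      rcases hxℓ with rfl | rfl
      · exact hℓW
      · exact hℓ'W
    have hB := isBase_insert_sdiff_of_notMem_closure hW hb hxE hxW hx
    refine hB.spanning.superset ?_ hZE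
    intro y hy
    rcases hy with rfl | hy
    · exact Set.mem_union_right _ hxℓ
    · exact Set.mem_union_left _ hy
  -- the complement of `Z` contains `(L' ∖ {ℓ, ℓ'}) ∪ C ∪ {b}`
  have hcompl : (L' \ {ℓ, ℓ'}) ∪ C ∪ {b} ⊆ N.E \ Z := by
    intro x hx
    rcases hx with (hx | hx) | hx
    · refine ⟨hLE hx.1, ?_⟩
      rintro (hxW | hxℓ)
      · exact hLW x hx.1 hxW.1
      · exact hx.2 hxℓ
    · refine ⟨hCE hx, ?_⟩
      rintro (hxW | hxℓ)
      · exact hCW x hx hxW.1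
      · rcases hxℓ with rfl | rfl
        · exact hdj.notMem_of_mem_left hx hℓ
        · exact hdj.notMem_of_mem_left hx hℓ'
    · rw [Set.mem_singleton_iff] at hx
      subst hx
      refine ⟨hWE hb, ?_⟩
      rintro (hxW | hxℓ)
      · exact hxW.2 rfl
      · rcases hxℓ with h | h
        · exact hbℓ h
        · exact hbℓ' h
  -- (2) `E ∖ Z` spans: `L' ∖ {ℓ, ℓ'}` has `≥ 2` elements, `b ∈ cl L'`, and together they span the line
  have hfin : L'.Finite := N.ground_finite.subset hLE
  have hEZsp : N.Spanning (N.E \ Z) := by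
    rw [Matroid.spanning_iff_ground_subset_closure Set.sdiff_subset]
    -- `L'' := (L' ∖ {ℓ, ℓ'}) ∪ {b}` has rank `≥ 2` and `≥ 3` elements, hence `cl L'' ⊇ L'`
    set L'' := (L' \ {ℓ, ℓ'}) ∪ {b} with hL''
    have hbL' : b ∉ L' := fun h => hLW b h hb
    have hL''E : L'' ⊆ N.E := by
      intro x hx
      rcases hx with hx | hx
      · exact hLE hx.1
      · rw [Set.mem_singleton_iff] at hx; rw [hx]; exact hWE hb
    have hL''card : 2 < L''.ncard := by
      have hbnot : b ∉ L' \ {ℓ, ℓ'} := fun h => hbL' h.1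
      rw [hL'', Set.union_singleton, Set.ncard_insert_of_notMem hbnot (hfin.subset Set.sdiff_subset)]
      have : (L' \ {ℓ, ℓ'}).ncard = L'.ncard - 2 := by
        have e : L' \ {ℓ, ℓ'} = (L' \ {ℓ}) \ {ℓ'} := by
          ext x; simp only [Set.mem_sdiff, Set.mem_singleton_iff, Set.mem_insert_iff]; tauto
        have hℓ'mem : ℓ' ∈ L' \ {ℓ} := ⟨hℓ', fun h => hne (by rw [Set.mem_singleton_iff] at h; exact h.symm)⟩
        rw [e, Set.ncard_sdiff_singleton_of_mem hℓ'mem, Set.ncard_sdiff_singleton_of_mem hℓ]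
        omega
      omega
    -- `L'' ⊆ cl L'`, so `cl L'' ⊆ cl L'` has rank `≤ 2`; and rank `L'' ≥ 2` by the triple-freeness
    have hL''cl : L'' ⊆ N.closure L' := by
      intro x hx
      rcases hx with hx | hx
      · exact N.subset_closure _ hLE hx.1
      · rw [Set.mem_singleton_iff] at hx; rw [hx]; exact hbL
    have h2 : 2 ≤ N.eRk L'' :=
      two_le_eRk_of_two_lt_ncard hL''E (fun e he => hnl e (hL''E he))
        (fun p hp q hq r hr => hnt p (hL''E hp) q (hL''E hq) r (hL''E hr)) hL''card
    -- every point of `L'` is in `cl L''`: otherwise the rank of `L'' ∪ {x}` would be `3` inside `cl L'`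
    have hLcl : L' ⊆ N.closure L'' := by
      intro x hx
      by_contra hcon
      have hins : N.eRk (insert x L'') = N.eRk L'' + 1 := Matroid.eRk_insert_eq_add_one ⟨hLE hx, hcon⟩
      have hle : N.eRk (insert x L'') ≤ N.eRk L' := by
        have : insert x L'' ⊆ N.closure L' := Set.insert_subset (N.subset_closure _ hLE hx) hL''cl
        calc N.eRk (insert x L'') ≤ N.eRk (N.closure L') := N.eRk_mono this
          _ = N.eRk L' := N.eRk_closure_eq L'
      have h3 : (3 : ℕ∞) ≤ N.eRk L' := by
        calc (3 : ℕ∞) = 2 + 1 := by norm_num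
          _ ≤ N.eRk L'' + 1 := by gcongr
          _ = N.eRk (insert x L'') := hins.symm
          _ ≤ N.eRk L' := hle
      have h32 : (3 : ℕ∞) ≤ 2 := h3.trans hL2
      have h32' : (3 : ℕ) ≤ 2 := by exact_mod_cast h32
      omega
    have h1 : C ∪ L' ⊆ N.closure (N.E \ Z) := by
      intro x hx
      rcases hx with hx | hx
      · exact N.subset_closure _ Set.sdiff_subset (hcompl (Set.mem_union_left _ (Set.mem_union_right _ hx)))
      · have hL''sub : L'' ⊆ N.E \ Z := by
          intro y hy
          rcases hy with hy | hy
          · exact hcompl (Set.mem_union_left _ (Set.mem_union_left _ hy))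
          · exact hcompl (Set.mem_union_right _ hy)
        exact N.closure_subset_closure hL''sub (hLcl hx)
    have h2' : N.closure (C ∪ L') ⊆ N.closure (N.E \ Z) := N.closure_subset_closure_of_subset_closure h1
    rw [hYsp.closure_eq] at h2'
    exact h2'
  -- (3) the coloops
  refine ⟨hZsp, hEZsp, ?_⟩
  intro t ht hsp
  -- `(E ∖ Z) ∖ t ⊆ L' ∪ (C ∖ {t}) ∪ {b} ⊆ cl L' ∪ (C ∖ {t})`, of rank `≤ 2 + 2`
  have hsub : (N.E \ Z) \ {t} ⊆ L' ∪ (C \ {t}) ∪ {b} := by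
    intro x hx
    obtain ⟨⟨hxE, hxZ⟩, hxt⟩ := hx
    rw [Set.mem_singleton_iff] at hxt
    by_cases hxb : x = b
    · exact Set.mem_union_right _ (by rw [Set.mem_singleton_iff]; exact hxb)
    · have hxW : x ∉ W := fun h => hxZ (Set.mem_union_left _ ⟨h, hxb⟩)
      have hxY : x ∈ C ∪ L' := hY ▸ ⟨hxE, hxW⟩
      rcases hxY with hxC | hxL
      · exact Set.mem_union_left _ (Set.mem_union_right _ ⟨hxC, by rw [Set.mem_singleton_iff]; exact hxt⟩)
      · exact Set.mem_union_left _ (Set.mem_union_left _ hxL)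
  have hCfin : C.Finite := N.ground_finite.subset hCE
  have hC2 : (C \ {t}).encard = 2 := by
    have hfin' : (C \ {t}).Finite := hCfin.subset Set.sdiff_subset
    rw [hfin'.encard_eq_coe_toFinset_card, ← Set.ncard_eq_toFinset_card _ hfin',
      Set.ncard_sdiff_singleton_of_mem ht, hC3]; rfl
  -- `b ∈ cl L'`, so the rank of `L' ∪ {b}` is that of `L'`
  have hrk : N.eRk (L' ∪ (C \ {t}) ∪ {b}) ≤ 4 := by
    have e : L' ∪ (C \ {t}) ∪ {b} = (L' ∪ {b}) ∪ (C \ {t}) := by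
      ext x; simp only [Set.mem_union, Set.mem_singleton_iff]; tauto
    rw [e]
    have hLb : N.eRk (L' ∪ {b}) = N.eRk L' := by
      rw [Set.union_singleton, ← N.eRk_closure_eq (insert b L'), Matroid.closure_insert_eq_of_mem_closure hbL,
        N.eRk_closure_eq]
    calc N.eRk ((L' ∪ {b}) ∪ (C \ {t})) ≤ N.eRk (L' ∪ {b}) + N.eRk (C \ {t}) := N.eRk_union_le_eRk_add_eRk _ _
      _ ≤ 2 + 2 := by
          gcongr
          · rw [hLb]; exact hL2
          · exact (N.eRk_le_encard _).trans (by rw [hC2])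
      _ = 4 := by norm_num
  have h5' : N.eRk ((N.E \ Z) \ {t}) = 5 := by rw [hsp.eRk_eq, h5]
  have h54 : (5 : ℕ∞) ≤ 4 := by
    calc (5 : ℕ∞) = N.eRk ((N.E \ Z) \ {t}) := h5'.symm
      _ ≤ N.eRk (L' ∪ (C \ {t}) ∪ {b}) := N.eRk_mono hsub
      _ ≤ 4 := hrk
  have h54' : (5 : ℕ) ≤ 4 := by exact_mod_cast h54
  omega

end PercRepro
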